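import Mathlib
import HarnessLib
import Summits.HubbardSuperconductivity.HubbardSuperconductivity.Theorems.KLProgrammeKLRegimeSectorSliceRowsMomentGeneric
import Summits.HubbardSuperconductivity.HubbardSuperconductivity.Theorems.KLProgrammeKLRegimeEngineScaleWtSliceRows

/-!
# Route `KLProgramme` — crux K3 ENGINE (stmt-…-20437) stub (b) conj. 2 «(c-D)² FAMILY TELESCOPE», brick (D4): the FAMILY DEFECT of a sectorised normal
# covariance — weighted rows/columns of `S(F′)ᵀ·C·S(F′) − S(F)ᵀ·C·S(F)` reduce to weighted character sums of the PAIR-SYMBOL DIFFERENCE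
# `(βL²)⁻²·(F′_ωF′_{ω′} − F_ωF_{ω′})·P`

Cell `gate-hubbard-kl`, seat hubbard-kl-k3c3-p2 (g10).  The simultaneous telescope (F1-DESIGN.md §2) steps from `(K_m, F^{K_m})` to `(K_{m+1}, F^{K_{m+1}})` in
TWO defects: the covariance defect at fixed family (k3c4-p2 `…SectorSliceDefectRows`: `S(F)ᵀ(C′−C)S(F)`) and the FAMILY defect at fixed covariance (this file).
No two-family matrix algebra is needed: the entry of `S(F′)ᵀN_pS(F′) − S(F)ᵀN_pS(F)` is ONE contraction sum with the symbol `(βL²)⁻²(F′_ωF′_{ω′} − F_ωF_{ω′})p`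
(`sectorSub_pullback_normalCovariance_apply` twice + linearity), and `F′_ωF′_{ω′} − F_ωF_{ω′} = (F′_ω − F_ω)F_{ω′} + F′_ω(F′_{ω′} − F_{ω′})` puts every term in the
increment-pair form of `…FatMultiplierIncrementSampled{,Time}` (brick (D2b)).

* `norm_pullback_normalCovariance_familySub_le` — the entry bound (two orientations, as `HubbardSpaceTimeCharacters.norm_pullback_normalCovariance_le`);
* `rowSumWt_/colSumWt_norm_pullback_normalCovariance_familySub_le` — weighted rows/columns for any nonnegative even weight `w` (twin of
  `…SectorSliceRowsMomentGeneric`);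
* **`rowSum_/colSum_klScaleWt_sliceCT_familySub_le`** — the `klScaleWt L M β n` currency at the counterterm slice covariance `C^K_{(Λ,Λ′]}` (twin of
  `EngineV8.rowSum_klScaleWt_sliceCT_le` / k3c4-p2's `rowSum_klScaleWt_sliceCT_sub_le`).

Everything is proved; no definitions, no sorry.  Nothing asserts superconductivity. [cite: BenfattoGiulianiMastropietro2006, §2.7 (2.66)–(2.67), §3 (3.2)–(3.3)]
-/

noncomputable section

namespace Summit.HubbardSuperconductivity.HubbardSuperconductivity.Theorems.TorusFourierL2

set_option linter.dupNamespace false -- summit = problem name (single-conjunct summit), D-0017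

open Finset Complex Literature.MathematicalPhysics.QuantumLattice Literature.Probability.LatticeModels
open Summit.HubbardSuperconductivity.HubbardSuperconductivity.Theorems.KLRegimeSplit
open Summit.HubbardSuperconductivity.HubbardSuperconductivity.Theorems.KLProgrammeLegKernels
open Summit.HubbardSuperconductivity.HubbardSuperconductivity.Theorems.EngineV8
open scoped Real

section Entry

variable {L M N : ℕ} [NeZero L] [NeZero M]

/-- **Entry bound of the family defect**: for a normal covariance with symbol `p` and two multiplier families `F′`, `F`, the entry
`(S(F′)ᵀN_pS(F′) − S(F)ᵀN_pS(F))(Y,Y′)` has norm at most the sum over the two orientations of `‖Σ_q χ_{q₁}(x₀−y₀)χ_{q₂}(x⃗−y⃗) • G^Δ(q)‖`,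
`G^Δ = (βL²)⁻²(F′_ωF′_{ω′} − F_ωF_{ω′})·p(·,σ)`. [cite: BenfattoGiulianiMastropietro2006, §2.7 (2.66)–(2.67)] -/
theorem norm_pullback_normalCovariance_familySub_le {β : ℝ} (hβ : β ≠ 0) (F' F : Fin N → FreqMomentum L M → ℂ)
    (p : FreqMomentum L M × Fin 2 → ℂ) (Y Y' : SpaceTimeIdx L M × SectorLeg N) :
    ‖((sectorSubMatrix L M β F').transpose * normalCovariance L M p * sectorSubMatrix L M β F' -
        (sectorSubMatrix L M β F).transpose * normalCovariance L M p * sectorSubMatrix L M β F) Y Y'‖ ≤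
      ‖∑ q : TorusSite 1 (2 * M) × TorusSite 2 L,
          (torusChar q.1 (fun _ : Fin 1 => ((Y.1.1 : ℕ) : ZMod (2 * M)) - ((Y'.1.1 : ℕ) : ZMod (2 * M))) *
              torusChar q.2 (Y.1.2 - Y'.1.2)) •
            ((((1 / (β * (L : ℝ) ^ 2) : ℝ) : ℂ) ^ 2 *
              ((F' Y.2.1.1 (⟨(q.1 0).val, ZMod.val_lt (q.1 0)⟩, q.2) * F' Y'.2.1.1 (⟨(q.1 0).val, ZMod.val_lt (q.1 0)⟩, q.2) -
                F Y.2.1.1 (⟨(q.1 0).val, ZMod.val_lt (q.1 0)⟩, q.2) * F Y'.2.1.1 (⟨(q.1 0).val, ZMod.val_lt (q.1 0)⟩, q.2)) *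
                  p ((⟨(q.1 0).val, ZMod.val_lt (q.1 0)⟩, q.2), Y.2.1.2))))‖ +
      ‖∑ q : TorusSite 1 (2 * M) × TorusSite 2 L,
          (torusChar q.1 (fun _ : Fin 1 => ((Y'.1.1 : ℕ) : ZMod (2 * M)) - ((Y.1.1 : ℕ) : ZMod (2 * M))) *
              torusChar q.2 (Y'.1.2 - Y.1.2)) •
            ((((1 / (β * (L : ℝ) ^ 2) : ℝ) : ℂ) ^ 2 *
              ((F' Y.2.1.1 (⟨(q.1 0).val, ZMod.val_lt (q.1 0)⟩, q.2) * F' Y'.2.1.1 (⟨(q.1 0).val, ZMod.val_lt (q.1 0)⟩, q.2) -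
                F Y.2.1.1 (⟨(q.1 0).val, ZMod.val_lt (q.1 0)⟩, q.2) * F Y'.2.1.1 (⟨(q.1 0).val, ZMod.val_lt (q.1 0)⟩, q.2)) *
                  p ((⟨(q.1 0).val, ZMod.val_lt (q.1 0)⟩, q.2), Y.2.1.2))))‖ := by
  set G : FreqMomentum L M → ℂ := fun k =>
    (((1 / (β * (L : ℝ) ^ 2) : ℝ) : ℂ) ^ 2 * ((F' Y.2.1.1 k * F' Y'.2.1.1 k - F Y.2.1.1 k * F Y'.2.1.1 k) * p (k, Y.2.1.2))) with hG
  have hA := norm_sum_conj_hubbardPlaneWave_mul_eq hβ G Y.1 Y'.1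
  have hB := norm_sum_conj_hubbardPlaneWave_mul_eq hβ G Y'.1 Y.1
  simp only [hG] at hA hB
  rw [← hA, ← hB]
  rw [Matrix.sub_apply, sectorSub_pullback_normalCovariance_apply, sectorSub_pullback_normalCovariance_apply]
  by_cases hσ : Y.2.1.2 = Y'.2.1.2
  · rw [if_pos hσ, if_pos hσ, ← Finset.sum_sub_distrib]
    by_cases h01 : Y.2.2 = 0 ∧ Y'.2.2 = 1
    · -- orientation `(+,-)`
      refine le_trans (le_of_eq ?_) (le_add_of_nonneg_right (norm_nonneg _))
      congr 1
      refine Finset.sum_congr rfl fun k _ => ?_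
      rw [if_pos h01, h01.1, h01.2]
      ring
    · by_cases h10 : Y.2.2 = 1 ∧ Y'.2.2 = 0
      · -- orientation `(-,+)`
        refine le_trans (le_of_eq ?_) (le_add_of_nonneg_left (norm_nonneg _))
        rw [← norm_neg]
        congr 1
        rw [← Finset.sum_neg_distrib]
        refine Finset.sum_congr rfl fun k _ => ?_
        rw [if_neg h01, if_pos h10, h10.1, h10.2]
        ring
      · refine le_trans (le_of_eq ?_) (add_nonneg (norm_nonneg _) (norm_nonneg _))
        rw [norm_eq_zero]
        exact Finset.sum_eq_zero fun k _ => by rw [if_neg h01, if_neg h10, mul_zero, zero_mul, mul_zero, zero_mul, sub_self]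
  · rw [if_neg hσ, if_neg hσ, sub_zero, norm_zero]
    positivity

end Entry

section Rows

variable {L M N : ℕ} [NeZero L] [NeZero M]

/-- **Weighted row sums of the family defect** of a sectorised normal covariance with spin-free symbol `P(ω, k⃗)`: for every nonnegative even weight
`w` and every `Y = (x, ((ω,σ),c))`, `Σ_{Y′} ‖(S(F′)ᵀNS(F′) − S(F)ᵀNS(F)) Y Y′‖·w(x − x′) ≤ 8·Σ_{ω′}Σ_z w(z)‖Σ_q χχ • G^Δ_{ωω′}(q)‖`,
`G^Δ_{ωω′} = (βL²)⁻²(F′_ωF′_{ω′} − F_ωF_{ω′})P`. [cite: BenfattoGiulianiMastropietro2006, §2.7 (2.66)–(2.67), §3 (3.3)] -/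
theorem rowSumWt_norm_pullback_normalCovariance_familySub_le {β : ℝ} (hβ : β ≠ 0) (P : ℝ → TorusSite 2 L → ℂ)
    (F' F : Fin N → FreqMomentum L M → ℂ) (w : TorusSite 1 (2 * M) × TorusSite 2 L → ℝ) (hw0 : ∀ z, 0 ≤ w z)
    (hw : ∀ a b, w (-a, -b) = w (a, b)) (Y : SpaceTimeIdx L M × SectorLeg N) :
    ∑ Y' : SpaceTimeIdx L M × SectorLeg N,
        ‖((sectorSubMatrix L M β F').transpose * normalCovariance L M (fun ks => P (matsubaraFreq β M ks.1.1) ks.1.2) * sectorSubMatrix L M β F' -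
            (sectorSubMatrix L M β F).transpose * normalCovariance L M (fun ks => P (matsubaraFreq β M ks.1.1) ks.1.2) * sectorSubMatrix L M β F) Y Y'‖ *
          w ((fun _ : Fin 1 => ((Y.1.1 : ℕ) : ZMod (2 * M)) - ((Y'.1.1 : ℕ) : ZMod (2 * M))), Y.1.2 - Y'.1.2) ≤
      8 * ∑ ω' : Fin N, ∑ z : TorusSite 1 (2 * M) × TorusSite 2 L, w z *
        ‖∑ q : TorusSite 1 (2 * M) × TorusSite 2 L, (torusChar q.1 z.1 * torusChar q.2 z.2) •
          ((((1 / (β * (L : ℝ) ^ 2) : ℝ) : ℂ) ^ 2 *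
            ((F' Y.2.1.1 (⟨(q.1 0).val, ZMod.val_lt (q.1 0)⟩, q.2) * F' ω' (⟨(q.1 0).val, ZMod.val_lt (q.1 0)⟩, q.2) -
              F Y.2.1.1 (⟨(q.1 0).val, ZMod.val_lt (q.1 0)⟩, q.2) * F ω' (⟨(q.1 0).val, ZMod.val_lt (q.1 0)⟩, q.2)) *
              P (matsubaraFreq β M ⟨(q.1 0).val, ZMod.val_lt (q.1 0)⟩) q.2)))‖ := by
  classical
  set p : FreqMomentum L M × Fin 2 → ℂ := fun ks => P (matsubaraFreq β M ks.1.1) ks.1.2 with hp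
  set D : Matrix (SpaceTimeIdx L M × SectorLeg N) (SpaceTimeIdx L M × SectorLeg N) ℂ :=
    (sectorSubMatrix L M β F').transpose * normalCovariance L M p * sectorSubMatrix L M β F' -
      (sectorSubMatrix L M β F).transpose * normalCovariance L M p * sectorSubMatrix L M β F with hD
  set T : Fin N → TorusSite 1 (2 * M) × TorusSite 2 L → ℝ := fun ω' z =>
    ‖∑ q : TorusSite 1 (2 * M) × TorusSite 2 L, (torusChar q.1 z.1 * torusChar q.2 z.2) •
      ((((1 / (β * (L : ℝ) ^ 2) : ℝ) : ℂ) ^ 2 *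
        ((F' Y.2.1.1 (⟨(q.1 0).val, ZMod.val_lt (q.1 0)⟩, q.2) * F' ω' (⟨(q.1 0).val, ZMod.val_lt (q.1 0)⟩, q.2) -
          F Y.2.1.1 (⟨(q.1 0).val, ZMod.val_lt (q.1 0)⟩, q.2) * F ω' (⟨(q.1 0).val, ZMod.val_lt (q.1 0)⟩, q.2)) *
          p ((⟨(q.1 0).val, ZMod.val_lt (q.1 0)⟩, q.2), Y.2.1.2))))‖ with hT
  rw [Fintype.sum_prod_type_right]
  have hℓ : ∀ ℓ' : SectorLeg N, ∑ y : SpaceTimeIdx L M,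
      ‖D Y (y, ℓ')‖ * w ((fun _ : Fin 1 => ((Y.1.1 : ℕ) : ZMod (2 * M)) - ((y.1 : ℕ) : ZMod (2 * M))), Y.1.2 - y.2) ≤
        2 * ∑ z : TorusSite 1 (2 * M) × TorusSite 2 L, w z * T ℓ'.1.1 z := by
    intro ℓ'
    calc ∑ y : SpaceTimeIdx L M, ‖D Y (y, ℓ')‖ * w ((fun _ : Fin 1 => ((Y.1.1 : ℕ) : ZMod (2 * M)) - ((y.1 : ℕ) : ZMod (2 * M))), Y.1.2 - y.2)
        ≤ ∑ y : SpaceTimeIdx L M,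
            ((fun z => w z * T ℓ'.1.1 z) ((fun _ : Fin 1 => ((Y.1.1 : ℕ) : ZMod (2 * M)) - ((y.1 : ℕ) : ZMod (2 * M))), Y.1.2 - y.2) +
              (fun z => w z * T ℓ'.1.1 z) ((fun _ : Fin 1 => ((y.1 : ℕ) : ZMod (2 * M)) - ((Y.1.1 : ℕ) : ZMod (2 * M))), y.2 - Y.1.2)) := by
          refine Finset.sum_le_sum fun y _ => ?_
          have h := norm_pullback_normalCovariance_familySub_le hβ F' F p Y (y, ℓ')
          have hwrev : w ((fun _ : Fin 1 => ((y.1 : ℕ) : ZMod (2 * M)) - ((Y.1.1 : ℕ) : ZMod (2 * M))), y.2 - Y.1.2) =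
              w ((fun _ : Fin 1 => ((Y.1.1 : ℕ) : ZMod (2 * M)) - ((y.1 : ℕ) : ZMod (2 * M))), Y.1.2 - y.2) := by
            rw [spaceTimeDiff_rev_eq_neg Y.1 y, hw]
          dsimp only
          rw [hwrev]
          have hmul := mul_le_mul_of_nonneg_right h (hw0 ((fun _ : Fin 1 => ((Y.1.1 : ℕ) : ZMod (2 * M)) - ((y.1 : ℕ) : ZMod (2 * M))), Y.1.2 - y.2))
          rw [hD]
          refine hmul.trans (le_of_eq ?_)
          simp only [hT]
          ring
      _ = ∑ z : TorusSite 1 (2 * M) × TorusSite 2 L, w z * T ℓ'.1.1 z + ∑ z : TorusSite 1 (2 * M) × TorusSite 2 L, w z * T ℓ'.1.1 z := by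
          rw [Finset.sum_add_distrib, sum_spaceTime_eq_sum_prodTorus (fun z => w z * T ℓ'.1.1 z) Y.1,
            sum_spaceTime_eq_sum_prodTorus_rev (fun z => w z * T ℓ'.1.1 z) Y.1]
      _ = 2 * ∑ z : TorusSite 1 (2 * M) × TorusSite 2 L, w z * T ℓ'.1.1 z := by ring
  calc ∑ ℓ' : SectorLeg N, ∑ y : SpaceTimeIdx L M,
        ‖D Y (y, ℓ')‖ * w ((fun _ : Fin 1 => ((Y.1.1 : ℕ) : ZMod (2 * M)) - ((y.1 : ℕ) : ZMod (2 * M))), Y.1.2 - y.2)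
      ≤ ∑ ℓ' : SectorLeg N, 2 * ∑ z : TorusSite 1 (2 * M) × TorusSite 2 L, w z * T ℓ'.1.1 z := Finset.sum_le_sum fun ℓ' _ => hℓ ℓ'
    _ = ∑ ω' : Fin N, ∑ _σ' : Fin 2, ∑ _c' : Fin 2, 2 * ∑ z : TorusSite 1 (2 * M) × TorusSite 2 L, w z * T ω' z := by
        rw [Fintype.sum_prod_type, Fintype.sum_prod_type]
    _ = 8 * ∑ ω' : Fin N, ∑ z : TorusSite 1 (2 * M) × TorusSite 2 L, w z * T ω' z := by
        rw [Finset.mul_sum]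
        refine Finset.sum_congr rfl fun ω' _ => ?_
        simp only [Finset.sum_const, Finset.card_univ, Fintype.card_fin]
        ring
    _ = _ := by rw [hT]

/-- **Weighted column sums of the family defect** (symbol read at the spin of `Y′`). [cite: BenfattoGiulianiMastropietro2006, §2.7 (2.66)–(2.67), §3 (3.3)] -/
theorem colSumWt_norm_pullback_normalCovariance_familySub_le {β : ℝ} (hβ : β ≠ 0) (P : ℝ → TorusSite 2 L → ℂ)
    (F' F : Fin N → FreqMomentum L M → ℂ) (w : TorusSite 1 (2 * M) × TorusSite 2 L → ℝ) (hw0 : ∀ z, 0 ≤ w z)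
    (hw : ∀ a b, w (-a, -b) = w (a, b)) (Y' : SpaceTimeIdx L M × SectorLeg N) :
    ∑ Y : SpaceTimeIdx L M × SectorLeg N,
        ‖((sectorSubMatrix L M β F').transpose * normalCovariance L M (fun ks => P (matsubaraFreq β M ks.1.1) ks.1.2) * sectorSubMatrix L M β F' -
            (sectorSubMatrix L M β F).transpose * normalCovariance L M (fun ks => P (matsubaraFreq β M ks.1.1) ks.1.2) * sectorSubMatrix L M β F) Y Y'‖ *
          w ((fun _ : Fin 1 => ((Y.1.1 : ℕ) : ZMod (2 * M)) - ((Y'.1.1 : ℕ) : ZMod (2 * M))), Y.1.2 - Y'.1.2) ≤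
      8 * ∑ ω : Fin N, ∑ z : TorusSite 1 (2 * M) × TorusSite 2 L, w z *
        ‖∑ q : TorusSite 1 (2 * M) × TorusSite 2 L, (torusChar q.1 z.1 * torusChar q.2 z.2) •
          ((((1 / (β * (L : ℝ) ^ 2) : ℝ) : ℂ) ^ 2 *
            ((F' ω (⟨(q.1 0).val, ZMod.val_lt (q.1 0)⟩, q.2) * F' Y'.2.1.1 (⟨(q.1 0).val, ZMod.val_lt (q.1 0)⟩, q.2) -
              F ω (⟨(q.1 0).val, ZMod.val_lt (q.1 0)⟩, q.2) * F Y'.2.1.1 (⟨(q.1 0).val, ZMod.val_lt (q.1 0)⟩, q.2)) *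
              P (matsubaraFreq β M ⟨(q.1 0).val, ZMod.val_lt (q.1 0)⟩) q.2)))‖ := by
  classical
  set p : FreqMomentum L M × Fin 2 → ℂ := fun ks => P (matsubaraFreq β M ks.1.1) ks.1.2 with hp
  set D : Matrix (SpaceTimeIdx L M × SectorLeg N) (SpaceTimeIdx L M × SectorLeg N) ℂ :=
    (sectorSubMatrix L M β F').transpose * normalCovariance L M p * sectorSubMatrix L M β F' -
      (sectorSubMatrix L M β F).transpose * normalCovariance L M p * sectorSubMatrix L M β F with hD
  set T : Fin N → TorusSite 1 (2 * M) × TorusSite 2 L → ℝ := fun ω z =>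
    ‖∑ q : TorusSite 1 (2 * M) × TorusSite 2 L, (torusChar q.1 z.1 * torusChar q.2 z.2) •
      ((((1 / (β * (L : ℝ) ^ 2) : ℝ) : ℂ) ^ 2 *
        ((F' ω (⟨(q.1 0).val, ZMod.val_lt (q.1 0)⟩, q.2) * F' Y'.2.1.1 (⟨(q.1 0).val, ZMod.val_lt (q.1 0)⟩, q.2) -
          F ω (⟨(q.1 0).val, ZMod.val_lt (q.1 0)⟩, q.2) * F Y'.2.1.1 (⟨(q.1 0).val, ZMod.val_lt (q.1 0)⟩, q.2)) *
          p ((⟨(q.1 0).val, ZMod.val_lt (q.1 0)⟩, q.2), Y'.2.1.2))))‖ with hT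
  rw [Fintype.sum_prod_type_right]
  have hℓ : ∀ ℓ : SectorLeg N, ∑ x : SpaceTimeIdx L M,
      ‖D (x, ℓ) Y'‖ * w ((fun _ : Fin 1 => ((x.1 : ℕ) : ZMod (2 * M)) - ((Y'.1.1 : ℕ) : ZMod (2 * M))), x.2 - Y'.1.2) ≤
        2 * ∑ z : TorusSite 1 (2 * M) × TorusSite 2 L, w z * T ℓ.1.1 z := by
    intro ℓ
    have hsym : ∀ (x : SpaceTimeIdx L M), ‖D (x, ℓ) Y'‖ ≤
          T ℓ.1.1 ((fun _ : Fin 1 => ((x.1 : ℕ) : ZMod (2 * M)) - ((Y'.1.1 : ℕ) : ZMod (2 * M))), x.2 - Y'.1.2) +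
            T ℓ.1.1 ((fun _ : Fin 1 => ((Y'.1.1 : ℕ) : ZMod (2 * M)) - ((x.1 : ℕ) : ZMod (2 * M))), Y'.1.2 - x.2) := by
      intro x
      have h := norm_pullback_normalCovariance_familySub_le hβ F' F p (x, ℓ) Y'
      have hpσ : ∀ k : FreqMomentum L M, p (k, ℓ.1.2) = p (k, Y'.2.1.2) := fun k => rfl
      simp only [hpσ] at h
      rw [hD]
      exact h
    calc ∑ x : SpaceTimeIdx L M, ‖D (x, ℓ) Y'‖ * w ((fun _ : Fin 1 => ((x.1 : ℕ) : ZMod (2 * M)) - ((Y'.1.1 : ℕ) : ZMod (2 * M))), x.2 - Y'.1.2)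
        ≤ ∑ x : SpaceTimeIdx L M,
            ((fun z => w z * T ℓ.1.1 z) ((fun _ : Fin 1 => ((x.1 : ℕ) : ZMod (2 * M)) - ((Y'.1.1 : ℕ) : ZMod (2 * M))), x.2 - Y'.1.2) +
              (fun z => w z * T ℓ.1.1 z) ((fun _ : Fin 1 => ((Y'.1.1 : ℕ) : ZMod (2 * M)) - ((x.1 : ℕ) : ZMod (2 * M))), Y'.1.2 - x.2)) := by
          refine Finset.sum_le_sum fun x _ => ?_
          have hwrev : w ((fun _ : Fin 1 => ((x.1 : ℕ) : ZMod (2 * M)) - ((Y'.1.1 : ℕ) : ZMod (2 * M))), x.2 - Y'.1.2) =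
              w ((fun _ : Fin 1 => ((Y'.1.1 : ℕ) : ZMod (2 * M)) - ((x.1 : ℕ) : ZMod (2 * M))), Y'.1.2 - x.2) := by
            rw [spaceTimeDiff_rev_eq_neg Y'.1 x, hw]
          dsimp only
          have hmul := mul_le_mul_of_nonneg_right (hsym x)
            (hw0 ((fun _ : Fin 1 => ((x.1 : ℕ) : ZMod (2 * M)) - ((Y'.1.1 : ℕ) : ZMod (2 * M))), x.2 - Y'.1.2))
          rw [hwrev] at hmul ⊢
          refine hmul.trans (le_of_eq ?_)
          ring
      _ = ∑ z : TorusSite 1 (2 * M) × TorusSite 2 L, w z * T ℓ.1.1 z + ∑ z : TorusSite 1 (2 * M) × TorusSite 2 L, w z * T ℓ.1.1 z := by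
          rw [Finset.sum_add_distrib, sum_spaceTime_eq_sum_prodTorus_rev (fun z => w z * T ℓ.1.1 z) Y'.1,
            sum_spaceTime_eq_sum_prodTorus (fun z => w z * T ℓ.1.1 z) Y'.1]
      _ = 2 * ∑ z : TorusSite 1 (2 * M) × TorusSite 2 L, w z * T ℓ.1.1 z := by ring
  calc ∑ ℓ : SectorLeg N, ∑ x : SpaceTimeIdx L M,
        ‖D (x, ℓ) Y'‖ * w ((fun _ : Fin 1 => ((x.1 : ℕ) : ZMod (2 * M)) - ((Y'.1.1 : ℕ) : ZMod (2 * M))), x.2 - Y'.1.2)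
      ≤ ∑ ℓ : SectorLeg N, 2 * ∑ z : TorusSite 1 (2 * M) × TorusSite 2 L, w z * T ℓ.1.1 z := Finset.sum_le_sum fun ℓ _ => hℓ ℓ
    _ = ∑ ω : Fin N, ∑ _σ : Fin 2, ∑ _c : Fin 2, 2 * ∑ z : TorusSite 1 (2 * M) × TorusSite 2 L, w z * T ω z := by
        rw [Fintype.sum_prod_type, Fintype.sum_prod_type]
    _ = 8 * ∑ ω : Fin N, ∑ z : TorusSite 1 (2 * M) × TorusSite 2 L, w z * T ω z := by
        rw [Finset.mul_sum]
        refine Finset.sum_congr rfl fun ω _ => ?_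
        simp only [Finset.sum_const, Finset.card_univ, Fintype.card_fin]
        ring
    _ = _ := by rw [hT]

end Rows

/-! ### The `klScaleWt` currency at the counterterm slice covariance -/

section KlScaleWt

variable {L M N : ℕ} [NeZero L] [NeZero M]

/-- **`hrow` of the FAMILY defect in `klScaleWt` currency**: for `D = S(F′)ᵀ·C^K_{(Λ,Λ′]}·S(F′) − S(F)ᵀ·C^K_{(Λ,Λ′]}·S(F)`, `0 < β`, every scale `n` and every
`Y = (x, ((ω,σ),c))`: `Σ_{Y′} ‖D Y Y′‖·klScaleWt L M β n {pos Y, pos Y′} ≤ 8·Σ_{ω′}Σ_z w_n(z)·‖Σ_q χχ • G^Δ_{ωω′}(q)‖`,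
`G^Δ_{ωω′}(q) = (βL²)⁻²(F′_ωF′_{ω′} − F_ωF_{ω′})(k_q)·Ψ̂_{ω(q₁)}(e_K(q₂))`. [cite: BenfattoGiulianiMastropietro2006, §2.7 (2.66)–(2.67), §3 (3.3)] -/
theorem rowSum_klScaleWt_sliceCT_familySub_le {β : ℝ} (hβ : 0 < β) (μ : ℝ) (K : TrigPolyC4v) (Λ Λ' : ℝ) (n : ℕ)
    (F' F : Fin N → FreqMomentum L M → ℂ) (Y : SpaceTimeIdx L M × SectorLeg N) :
    ∑ Y' : SpaceTimeIdx L M × SectorLeg N,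
        ‖((sectorSubMatrix L M β F').transpose * hubbardCovSliceCT L M β μ 0 K Λ Λ' * sectorSubMatrix L M β F' -
            (sectorSubMatrix L M β F).transpose * hubbardCovSliceCT L M β μ 0 K Λ Λ' * sectorSubMatrix L M β F) Y Y'‖ *
          klScaleWt L M β n {latticeLegPos (2 * (2 * M)) Y, latticeLegPos (2 * (2 * M)) Y'} ≤
      8 * ∑ ω' : Fin N, ∑ z : TorusSite 1 (2 * M) × TorusSite 2 L,
        (1 + klScale klE0 n * β / (2 * M) * |(((z.1 0).valMinAbs : ℤ) : ℝ)| + klScale klE0 n * |(((z.2 0).valMinAbs : ℤ) : ℝ)| +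
          klScale klE0 n * |(((z.2 1).valMinAbs : ℤ) : ℝ)|) *
        ‖∑ q : TorusSite 1 (2 * M) × TorusSite 2 L, (torusChar q.1 z.1 * torusChar q.2 z.2) •
          ((((1 / (β * (L : ℝ) ^ 2) : ℝ) : ℂ) ^ 2 *
            ((F' Y.2.1.1 (⟨(q.1 0).val, ZMod.val_lt (q.1 0)⟩, q.2) * F' ω' (⟨(q.1 0).val, ZMod.val_lt (q.1 0)⟩, q.2) -
              F Y.2.1.1 (⟨(q.1 0).val, ZMod.val_lt (q.1 0)⟩, q.2) * F ω' (⟨(q.1 0).val, ZMod.val_lt (q.1 0)⟩, q.2)) *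
              sliceSymbolFnXi (β * (L : ℝ) ^ 2) 0 Λ Λ' (matsubaraFreq β M ⟨(q.1 0).val, ZMod.val_lt (q.1 0)⟩) (nambuXiCT L μ K q.2))))‖ := by
  have hΛ : 0 ≤ klScale klE0 n := (klth_klScale_pos n).le
  have hs₀ : 0 ≤ klScale klE0 n * β / (2 * M) := by positivity
  set w : TorusSite 1 (2 * M) × TorusSite 2 L → ℝ := fun z =>
    1 + klScale klE0 n * β / (2 * M) * |(((z.1 0).valMinAbs : ℤ) : ℝ)| + klScale klE0 n * |(((z.2 0).valMinAbs : ℤ) : ℝ)| +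
      klScale klE0 n * |(((z.2 1).valMinAbs : ℤ) : ℝ)| with hw
  have hw0 : ∀ z, 0 ≤ w z := fun z => momentWt_nonneg hs₀ hΛ z
  have hweven : ∀ a b, w (-a, -b) = w (a, b) := fun a b => by simp only [hw]; exact momentWt_neg _ _ a b
  rw [hubbardCovSliceCT_eq_normalCovariance_sliceSymbolFnXi hβ.ne' μ K Λ Λ']
  have hrows := rowSumWt_norm_pullback_normalCovariance_familySub_le hβ.ne'
    (fun ω k => sliceSymbolFnXi (β * (L : ℝ) ^ 2) 0 Λ Λ' ω (nambuXiCT L μ K k)) F' F w hw0 hweven Y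
  refine le_trans (Finset.sum_le_sum fun Y' _ => mul_le_mul_of_nonneg_left ?_ (norm_nonneg _)) hrows
  have h := klScaleWt_pair_latticeLegPos_le (L := L) (M := M) hβ.le n Y Y'
  simp only [hw]
  exact h

/-- **`hcol` of the FAMILY defect in `klScaleWt` currency** (column twin). [cite: BenfattoGiulianiMastropietro2006, §2.7 (2.66)–(2.67), §3 (3.3)] -/
theorem colSum_klScaleWt_sliceCT_familySub_le {β : ℝ} (hβ : 0 < β) (μ : ℝ) (K : TrigPolyC4v) (Λ Λ' : ℝ) (n : ℕ)
    (F' F : Fin N → FreqMomentum L M → ℂ) (Y' : SpaceTimeIdx L M × SectorLeg N) :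
    ∑ Y : SpaceTimeIdx L M × SectorLeg N,
        ‖((sectorSubMatrix L M β F').transpose * hubbardCovSliceCT L M β μ 0 K Λ Λ' * sectorSubMatrix L M β F' -
            (sectorSubMatrix L M β F).transpose * hubbardCovSliceCT L M β μ 0 K Λ Λ' * sectorSubMatrix L M β F) Y Y'‖ *
          klScaleWt L M β n {latticeLegPos (2 * (2 * M)) Y, latticeLegPos (2 * (2 * M)) Y'} ≤
      8 * ∑ ω : Fin N, ∑ z : TorusSite 1 (2 * M) × TorusSite 2 L,
        (1 + klScale klE0 n * β / (2 * M) * |(((z.1 0).valMinAbs : ℤ) : ℝ)| + klScale klE0 n * |(((z.2 0).valMinAbs : ℤ) : ℝ)| +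
          klScale klE0 n * |(((z.2 1).valMinAbs : ℤ) : ℝ)|) *
        ‖∑ q : TorusSite 1 (2 * M) × TorusSite 2 L, (torusChar q.1 z.1 * torusChar q.2 z.2) •
          ((((1 / (β * (L : ℝ) ^ 2) : ℝ) : ℂ) ^ 2 *
            ((F' ω (⟨(q.1 0).val, ZMod.val_lt (q.1 0)⟩, q.2) * F' Y'.2.1.1 (⟨(q.1 0).val, ZMod.val_lt (q.1 0)⟩, q.2) -
              F ω (⟨(q.1 0).val, ZMod.val_lt (q.1 0)⟩, q.2) * F Y'.2.1.1 (⟨(q.1 0).val, ZMod.val_lt (q.1 0)⟩, q.2)) *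
              sliceSymbolFnXi (β * (L : ℝ) ^ 2) 0 Λ Λ' (matsubaraFreq β M ⟨(q.1 0).val, ZMod.val_lt (q.1 0)⟩) (nambuXiCT L μ K q.2))))‖ := by
  have hΛ : 0 ≤ klScale klE0 n := (klth_klScale_pos n).le
  have hs₀ : 0 ≤ klScale klE0 n * β / (2 * M) := by positivity
  set w : TorusSite 1 (2 * M) × TorusSite 2 L → ℝ := fun z =>
    1 + klScale klE0 n * β / (2 * M) * |(((z.1 0).valMinAbs : ℤ) : ℝ)| + klScale klE0 n * |(((z.2 0).valMinAbs : ℤ) : ℝ)| +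
      klScale klE0 n * |(((z.2 1).valMinAbs : ℤ) : ℝ)| with hw
  have hw0 : ∀ z, 0 ≤ w z := fun z => momentWt_nonneg hs₀ hΛ z
  have hweven : ∀ a b, w (-a, -b) = w (a, b) := fun a b => by simp only [hw]; exact momentWt_neg _ _ a b
  rw [hubbardCovSliceCT_eq_normalCovariance_sliceSymbolFnXi hβ.ne' μ K Λ Λ']
  have hcols := colSumWt_norm_pullback_normalCovariance_familySub_le hβ.ne'
    (fun ω k => sliceSymbolFnXi (β * (L : ℝ) ^ 2) 0 Λ Λ' ω (nambuXiCT L μ K k)) F' F w hw0 hweven Y'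
  refine le_trans (Finset.sum_le_sum fun Y _ => mul_le_mul_of_nonneg_left ?_ (norm_nonneg _)) hcols
  have h := klScaleWt_pair_latticeLegPos_le (L := L) (M := M) hβ.le n Y Y'
  simp only [hw]
  exact h

end KlScaleWt

end Summit.HubbardSuperconductivity.HubbardSuperconductivity.Theorems.TorusFourierL2

end
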